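import Literature.AlgebraicGeometry.Resolution.DChartModel
import Literature.AlgebraicGeometry.Resolution.HenselChartInField
import Literature.AlgebraicGeometry.Resolution.EtaleChartNormal
import Literature.AlgebraicGeometry.Resolution.SeparatingConstant
import Literature.AlgebraicGeometry.Resolution.UniqueExtensionBelowHenselization
import Literature.AlgebraicGeometry.Resolution.HenselizationHenselian
import Literature.AlgebraicGeometry.Resolution.DiscInChart
import HarnessLib

/-!
# The chart datum of Thm. 3.3.1 — II. The Hensel chart over the fine model, the constants, the sheet

Topic: `Literature/AlgebraicGeometry/Resolution`. M. Temkin, *Inseparable local uniformization*,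
J. Algebra 373 (2013) = arXiv:0804.1554v3, Thm. 3.3.1, smooth-fibre case (tree:
`Temkin2013RelativeCurveSmoothFibre`). Continuing `DChartModel.lean` for a chart datum
`C : RelCurveChart k K L₁ Ω`: over the base ring `R = N″ = Nr_{L₁}(A′)[1/f] ⊆ Ω` (an integrally
closed domain) the minimal polynomial `P` of the constant `y₀`, the approximant `y ∈ R` and the
Newton quotient `β ∈ R` satisfy the hypotheses of the Hensel chart (`HenselChartInField.lean`):

* `T₀ ⊆ O_V`, an ÉTALE `R`-subalgebra of `Ω` containing `y₀` — `exists_T₀` — PROVED;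
* the SEPARATING CONSTANT `μ ∈ Nr_m(k°)` (`SeparatingConstant.lean`) lies in `T₀`
  (relative integral closedness, `EtaleChartInField.lean`); after inverting it, every valuation
  ring over the chart contains the constant field `m = k(y₀)` or induces `m° = m ∩ O_V` on it,
  and then — `M ∩ L₁^h ⊆ m`, `UniqueExtensionBelowHenselization.lean` — induces `O_V` on the
  Galois extension `M`; consequently `m° ⊆ T₁ = T₀[1/μ]` (valuative membership,
  `EtaleChartNormal.lean`) — PROVED;
* the SHEET CUTTER `b` of the datum lies in `T₁`, and in `T = T₁[1/b]` so does the disc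
  coordinate `x′ = (x − a)/c` — PROVED.

Everything is [folklore] bookkeeping over the cited files; no named facts.

## Sources

* M. Temkin, arXiv:0804.1554v3, proof of Thm. 3.3.1, Steps 2–4 (pp. 44–45); Thm. 2.4.3 (iii).
-/

noncomputable section

open Polynomial IsLocalRing

namespace Literature.AlgebraicGeometry.Resolution

namespace RelCurveChart

universe u

variable {k K L₁ Ω : Type u} [Field k] [Field K] [Field L₁] [Field Ω]
  [Algebra k K] [Algebra K L₁] [Algebra k L₁] [IsScalarTower k K L₁]
  [Algebra L₁ Ω] [Algebra K Ω] [Algebra k Ω] [IsScalarTower K L₁ Ω] [IsScalarTower k L₁ Ω]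
  [IsAlgClosed Ω] [FiniteDimensional K L₁] (C : RelCurveChart k K L₁ Ω)

omit [IsAlgClosed Ω] in
/-- Valuative membership in an étale chart realized in `Ω` (wrapper around
`mem_range_of_forall_valuationSubring`). [folklore] -/
theorem mem_of_forall_valuationSubring_of_mul_mem {R : Type u} [CommRing R] [IsDomain R]
    [IsIntegrallyClosed R] [Algebra R Ω] (hR : Function.Injective (algebraMap R Ω))
    (T : Subalgebra R Ω) [Algebra.Etale R T] {z : Ω}
    (hval : ∀ W : ValuationSubring Ω, T.toSubring ≤ W.toSubring → z ∈ W)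
    {u : Ω} (huT : u ∈ T) (hu0 : u ≠ 0) (huz : u * z ∈ T) : z ∈ T := by
  have hval' : ∀ W : ValuationSubring Ω, (∀ w : T, algebraMap T Ω w ∈ W) → z ∈ W :=
    fun W hW => hval W fun w hw => hW ⟨w, hw⟩
  have hu : (⟨u, huT⟩ : T) ≠ 0 := fun h0 => hu0 (congrArg Subtype.val h0)
  have hzu : algebraMap T Ω ⟨u, huT⟩ * z = algebraMap T Ω ⟨u * z, huz⟩ := rfl
  obtain ⟨t, ht⟩ := mem_range_of_forall_valuationSubring (R := R) (T := T) (L := Ω)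
    hR Subtype.val_injective hval' hu hzu
  rw [← ht]
  exact t.2

omit [IsAlgClosed Ω] [FiniteDimensional K L₁] in
/-- `divX` commutes with ring maps. [folklore] -/
theorem map_divX {R S : Type u} [CommRing R] [CommRing S] (f : R →+* S) (p : Polynomial R) :
    (Polynomial.divX p).map f = Polynomial.divX (p.map f) :=
  Polynomial.ext fun n => by simp only [Polynomial.coeff_map, Polynomial.coeff_divX]

omit [IsAlgClosed Ω] [FiniteDimensional K L₁] in
/-- The zoomed polynomial commutes with ring maps. [folklore] -/
theorem map_zoomPoly {R S : Type u} [CommRing R] [CommRing S] (f : R →+* S) (P : Polynomial R)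
    (y β : R) : (zoomPoly P y β).map f = zoomPoly (P.map f) (f y) (f β) := by
  unfold zoomPoly
  rw [Polynomial.map_add, Polynomial.map_add, Polynomial.map_mul, Polynomial.map_pow,
    Polynomial.map_C, Polynomial.map_X, Polynomial.map_comp, map_divX, map_divX,
    Polynomial.map_taylor, Polynomial.map_mul, Polynomial.map_C, Polynomial.map_X,
    Polynomial.derivative_map, Polynomial.eval_map, Polynomial.eval₂_at_apply]

/-! ### The Hensel data over `R = N″` -/

/-- `P` over `R = N″` (its coefficients lie in `k° ⊆ N″`). [folklore] -/
theorem exists_PR : ∃ PR : Polynomial C.N'', PR.map (algebraMap C.N'' Ω) = C.PΩ := by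
  have hl : C.PΩ ∈ Polynomial.lifts (algebraMap C.N'' Ω) := by
    refine (Polynomial.lifts_iff_coeff_lifts _).mpr fun n => ?_
    refine ⟨⟨C.PΩ.coeff n, ?_⟩, rfl⟩
    rw [PΩ, coeff_map]
    exact C.algebraMap_mem_N''_of_mem_Ok (C.hPcoef n)
  exact (Polynomial.mem_lifts _).mp hl

/-- `P` over `R`. [folklore] -/
def PR : Polynomial C.N'' := C.exists_PR.choose

/-- `PR ↦ PΩ`. [folklore] -/
theorem PR_map : C.PR.map (algebraMap C.N'' Ω) = C.PΩ := C.exists_PR.choose_spec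

/-- `y ∈ R`. [folklore] -/
def yR : C.N'' := ⟨C.yΩ, C.yΩ_mem_N''⟩

/-- `β ∈ R`. [folklore] -/
def βR : C.N'' := ⟨algebraMap L₁ Ω C.βL, C.βΩ_mem_N''⟩

omit [IsAlgClosed Ω] [FiniteDimensional K L₁] in
/-- Pushing evaluation of a polynomial over an `Ω`-algebra base into `Ω`. [folklore] -/
theorem algebraMap_eval_base {R : Type u} [CommRing R] [Algebra R Ω] (Q : Polynomial R) (w : R) :
    algebraMap R Ω (Q.eval w) = (Q.map (algebraMap R Ω)).eval (algebraMap R Ω w) := by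
  rw [← Polynomial.coe_aeval_eq_eval, ← Polynomial.aeval_algebraMap_apply, Polynomial.aeval_def,
    Polynomial.eval_map]

/-- `PR(yR) ↦ PΩ(yΩ)`. [folklore] -/
theorem algebraMap_eval_PR : algebraMap C.N'' Ω (C.PR.eval C.yR) = C.PΩ.eval C.yΩ := by
  rw [algebraMap_eval_base, C.PR_map]
  rfl

/-- `PR′(yR) ↦ PΩ′(yΩ) = P′(y)`. [folklore] -/
theorem algebraMap_eval_derivative_PR :
    algebraMap C.N'' Ω ((derivative C.PR).eval C.yR) = (derivative C.PΩ).eval C.yΩ := by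
  rw [algebraMap_eval_base, ← derivative_map, C.PR_map]
  rfl

/-- **Newton divisibility in `R`**: `P(y) = P′(y)² β`. [folklore] -/
theorem PR_eval_eq : C.PR.eval C.yR = (derivative C.PR).eval C.yR ^ 2 * C.βR := by
  apply Subtype.val_injective
  change algebraMap C.N'' Ω (C.PR.eval C.yR) =
    algebraMap C.N'' Ω ((derivative C.PR).eval C.yR ^ 2 * C.βR)
  rw [map_mul, map_pow, algebraMap_eval_PR, algebraMap_eval_derivative_PR, ← C.algebraMap_PL_eval,
    C.PL_eval_eq, map_mul, map_pow, C.algebraMap_aL]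
  rfl

/-- `P′(y) ≠ 0` in `R`. [folklore] -/
theorem eval_derivative_PR_ne_zero : (derivative C.PR).eval C.yR ≠ 0 := fun h0 => by
  have h := C.algebraMap_eval_derivative_PR
  rw [h0, map_zero, ← C.algebraMap_aL, eq_comm, map_eq_zero] at h
  exact C.aL_ne_zero h

/-- `PR(y₀) = 0`. [folklore] -/
theorem aeval_y₀_PR : Polynomial.aeval C.y₀ C.PR = 0 := by
  rw [Polynomial.aeval_def, ← Polynomial.eval_map, C.PR_map, C.eval_PΩ_y₀]

/-- `PR′(y₀) ≠ 0`. [folklore] -/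
theorem aeval_y₀_derivative_PR_ne_zero : Polynomial.aeval C.y₀ (derivative C.PR) ≠ 0 := by
  rw [Polynomial.aeval_def, ← Polynomial.eval_map, ← derivative_map, C.PR_map]
  exact C.eval_derivative_PΩ_y₀_ne_zero

/-- The Newton closeness `|y₀ − y| < |P′(y)|` at `V`. [folklore] -/
theorem valuation_y₀_sub_yR_lt :
    C.V.valuation (C.y₀ - algebraMap C.N'' Ω C.yR) <
      C.V.valuation (algebraMap C.N'' Ω ((derivative C.PR).eval C.yR)) := by
  rw [algebraMap_eval_derivative_PR, ← C.algebraMap_aL, C.valuation_aL]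
  refine lt_of_lt_of_le C.valuation_y₀_sub_y_lt ?_
  exact pow_le_of_le_one zero_le C.valuation_derivative_y₀_le (by norm_num)

/-- `R ⊆ O_V`. [folklore] -/
theorem algebraMap_N''_mem_V (r : C.N'') : algebraMap C.N'' Ω r ∈ C.V := C.N''_le_V r.2

/-- The zoomed root `z₀ = (y₀ − y)/P′(y)`. [folklore] -/
def z₀ : Ω := (C.y₀ - C.yΩ) / (derivative C.PΩ).eval C.yΩ

/-- `z₀` in terms of the `R`-level data. [folklore] -/
theorem z₀_eq : C.z₀ = (C.y₀ - algebraMap C.N'' Ω C.yR) / algebraMap C.N'' Ω ((derivative C.PR).eval C.yR) := by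
  rw [z₀, algebraMap_eval_derivative_PR]
  rfl

/-- The co-unit `w₀ = p̃′(z₀)` of the Hensel chart (`u_D = w₀⁻¹`), `p̃ = zoomPoly PΩ y β` — an
explicit polynomial expression in `y₀, y, β` over `k`. [folklore] -/
def w₀ : Ω := (derivative (zoomPoly C.PΩ C.yΩ (algebraMap L₁ Ω C.βL))).eval C.z₀

/-- `w₀` is the value at `z₀` of the derivative of the `R`-level zoomed polynomial. [folklore] -/
theorem w₀_eq : C.w₀ = Polynomial.aeval
    ((C.y₀ - algebraMap C.N'' Ω C.yR) / algebraMap C.N'' Ω ((derivative C.PR).eval C.yR))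
    (derivative (zoomPoly C.PR C.yR C.βR)) := by
  rw [← z₀_eq, Polynomial.aeval_def, ← Polynomial.eval_map, ← Polynomial.derivative_map,
    map_zoomPoly, C.PR_map, w₀]
  rfl

/-! ### The Hensel chart `T₀` -/

/-- **The Hensel chart over the fine model**: an étale `R`-subalgebra `T₀ ⊆ O_V` of `Ω` with
`y₀ ∈ T₀`, generated over `R` by the zoomed root `z₀` and a unit `u_D` (of value `1`, lying in
every subfield containing `R` and `y₀`). [folklore] -/
theorem exists_T₀ : ∃ (T : Subalgebra C.N'' Ω) (uD : Ω), Algebra.Etale C.N'' T ∧ C.y₀ ∈ T ∧ uD ∈ T ∧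
    T = Algebra.adjoin C.N''
      ({(C.y₀ - algebraMap C.N'' Ω C.yR) / algebraMap C.N'' Ω ((derivative C.PR).eval C.yR), uD} :
        Set Ω) ∧
    (∀ F : Subfield Ω, (∀ r : C.N'', algebraMap C.N'' Ω r ∈ F) → C.y₀ ∈ F → uD ∈ F) ∧
    T.toSubring ≤ C.V.toSubring ∧ C.V.valuation uD = 1 ∧
    uD * Polynomial.aeval
      ((C.y₀ - algebraMap C.N'' Ω C.yR) / algebraMap C.N'' Ω ((derivative C.PR).eval C.yR))
      (derivative (zoomPoly C.PR C.yR C.βR)) = 1 := by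
  haveI : IsIntegrallyClosed C.N'' := C.isIntegrallyClosed_N''
  obtain ⟨T, uD, het, hy₀T, huT, hTeq, hF, hV, hurel⟩ :=
    exists_henselChart (R := C.N'') (L := Ω) Subtype.val_injective C.PR C.yR C.βR C.PR_eval_eq
      C.eval_derivative_PR_ne_zero C.y₀ C.aeval_y₀_PR C.aeval_y₀_derivative_PR_ne_zero
  obtain ⟨hTV, hvu⟩ := hV C.V C.algebraMap_N''_mem_V C.valuation_y₀_sub_yR_lt
  exact ⟨T, uD, het, hy₀T, huT, hTeq, hF, hTV, hvu, hurel⟩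

/-! ### The constants: `m = k(y₀)` as an intermediate field, denominators, membership in charts -/

/-- Membership in `m` is membership in `k(y₀)`. [folklore] -/
theorem mem_m_iff {z : Ω} : z ∈ C.m ↔ z ∈ IntermediateField.adjoin k ({C.y₀} : Set Ω) := by
  rw [C.hm]; rfl

/-- Every element of `m = k(y₀)` is a `k`-polynomial in `y₀`. [folklore] -/
theorem exists_aeval_eq_of_mem_m {z : Ω} (hz : z ∈ C.m) : ∃ q : Polynomial k, Polynomial.aeval C.y₀ q = z := by
  have h1 : z ∈ (IntermediateField.adjoin k ({C.y₀} : Set Ω)).toSubalgebra := C.mem_m_iff.mp hz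
  rw [IntermediateField.adjoin_simple_toSubalgebra_of_isAlgebraic C.hy₀int.isAlgebraic,
    Algebra.adjoin_singleton_eq_range_aeval] at h1
  exact h1

/-- An element of `k ↦ Ω` lying in `O_V` comes from `k°`. [folklore] -/
theorem exists_of_mem_kΩ_mem_V {d : Ω} (hdk : d ∈ kΩ (k := k) (Ω := Ω)) (hdV : d ∈ C.V) :
    ∃ d₀ ∈ C.Ok, algebraMap k Ω d₀ = d := by
  obtain ⟨d₀, rfl⟩ := hdk
  refine ⟨d₀, ?_, rfl⟩
  have : d₀ ∈ C.V.comap (algebraMap k Ω) := hdV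
  rwa [C.comap_k] at this

/-- **Constants lie on étale charts over `R` valuatively**: for an étale `R`-subalgebra `T` of
`Ω` containing `y₀`, an element `z ∈ m = k(y₀)` which lies in every valuation ring over `T`
lies in `T` (clear the `k`-denominators of `z = q(y₀)` by a constant of `k° ⊆ R` and use the
valuative membership criterion of `EtaleChartNormal.lean`). [folklore] -/
theorem mem_of_mem_m_of_forall {T : Subalgebra C.N'' Ω} (het : Algebra.Etale C.N'' T)
    (hy₀T : C.y₀ ∈ T) {z : Ω} (hz : z ∈ C.m)
    (hval : ∀ W : ValuationSubring Ω, T.toSubring ≤ W.toSubring → z ∈ W) : z ∈ T := by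
  classical
  haveI : Algebra.Etale C.N'' T := het
  haveI : IsIntegrallyClosed C.N'' := C.isIntegrallyClosed_N''
  obtain ⟨q, hq⟩ := C.exists_aeval_eq_of_mem_m hz
  -- a common denominator `d ∈ k°` for the coefficients of `q`
  set S : Finset Ω := (Finset.range (q.natDegree + 1)).image fun i => algebraMap k Ω (q.coeff i)
    with hS
  obtain ⟨d, hdk, hdV, hd0, hdS⟩ :=
    ConjugateDiscs.exists_mul_mem_valuationSubring_of_finset C.V (kΩ (k := k) (Ω := Ω)) S (by
      intro s hs
      obtain ⟨i, -, rfl⟩ := Finset.mem_image.mp hs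
      exact ⟨q.coeff i, rfl⟩)
  obtain ⟨d₀, hd₀, rfl⟩ := C.exists_of_mem_kΩ_mem_V hdk hdV
  have hcoef : ∀ i, algebraMap k Ω (d₀ * q.coeff i) ∈ T := by
    intro i
    by_cases hi : i ≤ q.natDegree
    · have h1 : algebraMap k Ω d₀ * algebraMap k Ω (q.coeff i) ∈ C.V :=
        hdS _ (Finset.mem_image.mpr ⟨i, Finset.mem_range.mpr (Nat.lt_succ_of_le hi), rfl⟩)
      rw [← map_mul] at h1
      obtain ⟨e₀, he₀, he⟩ := C.exists_of_mem_kΩ_mem_V ⟨_, rfl⟩ h1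
      rw [← he]
      exact T.algebraMap_mem ⟨_, C.algebraMap_mem_N''_of_mem_Ok he₀⟩
    · rw [Polynomial.coeff_eq_zero_of_natDegree_lt (not_le.mp hi), mul_zero, map_zero]
      exact T.zero_mem
  -- `d z ∈ T`
  have hdz : algebraMap k Ω d₀ * z ∈ T := by
    rw [← hq, Polynomial.aeval_eq_sum_range, Finset.mul_sum]
    refine T.sum_mem fun i _ => ?_
    rw [Algebra.smul_def, ← mul_assoc, ← map_mul]
    exact T.mul_mem (hcoef i) (T.pow_mem hy₀T i)
  -- the membership criterion
  exact mem_of_forall_valuationSubring_of_mul_mem (R := C.N'') Subtype.val_injective T hval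
    (T.algebraMap_mem ⟨_, C.algebraMap_mem_N''_of_mem_Ok hd₀⟩) hd0 hdz

/-! ### The separating constant `μ` -/

/-- `k°` is maximal among the proper valuation rings of `k` (height one). [folklore] -/
theorem Ok_max : ∀ S : ValuationSubring k, C.Ok ≤ S → S = C.Ok ∨ S = ⊤ := by
  haveI : Ring.KrullDimLE 1 C.Ok := (Ring.krullDimLE_iff (R := C.Ok)).mpr (by
    rw [C.hdimk]; exact le_rfl)
  intro S h1
  exact (ValuationSubring.eq_self_or_eq_top_of_le h1).imp Eq.symm id

/-- **The separating constant.** An element `μ ∈ m` with `|μ|_V = 1`, lying in every valuation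
ring containing `k°`, such that every valuation ring `W ⊇ k°` of `Ω` in which `μ` is a unit
either contains `m` or induces `m ∩ O_V` on `m`. [folklore] -/
theorem exists_μ : ∃ μ : Ω, μ ∈ C.m ∧ C.V.valuation μ = 1 ∧
    (∀ W : ValuationSubring Ω, (∀ c₀ ∈ C.Ok, algebraMap k Ω c₀ ∈ W) → μ ∈ W) ∧
    ∀ W : ValuationSubring Ω, (∀ c₀ ∈ C.Ok, algebraMap k Ω c₀ ∈ W) → W.valuation μ = 1 →
      (∀ z ∈ C.m, z ∈ W) ∨ (∀ z ∈ C.m, z ∈ W ↔ z ∈ C.V) := by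
  set l : IntermediateField k Ω := IntermediateField.adjoin k ({C.y₀} : Set Ω) with hl
  haveI : FiniteDimensional k l := IntermediateField.adjoin.finiteDimensional C.hy₀int
  set Wl : ValuationSubring l := C.V.comap (algebraMap l Ω) with hWl
  have hWlk : Wl.comap (algebraMap k l) = C.Ok := by
    rw [hWl, ValuationSubring.comap_comap, ← IsScalarTower.algebraMap_eq, C.comap_k]
  obtain ⟨μl, hμU, hμ1, hμlt⟩ := exists_separating_unit C.Ok Wl hWlk
  have hmemU : ∀ W : ValuationSubring Ω, (∀ c₀ ∈ C.Ok, algebraMap k Ω c₀ ∈ W) →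
      C.Ok ≤ (W.comap (algebraMap l Ω)).comap (algebraMap k l) := by
    intro W hW c₀ hc₀
    change algebraMap l Ω (algebraMap k l c₀) ∈ W
    rw [← IsScalarTower.algebraMap_apply]
    exact hW c₀ hc₀
  refine ⟨(μl : Ω), C.mem_m_iff.mpr μl.2, ?_, fun W hW => hμU _ (hmemU W hW), fun W hW hWμ => ?_⟩
  · -- `|μ|_V = 1`
    have h1 : (μl : Ω) ∈ C.V := (Wl.valuation_le_one_iff _).mp hμ1.le
    have h2 : ((μl : Ω))⁻¹ ∈ C.V := by
      have : μl⁻¹ ∈ Wl := (Wl.valuation_le_one_iff _).mp (by rw [map_inv₀, hμ1, inv_one])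
      exact this
    have hμ0 : (μl : Ω) ≠ 0 := fun h0 => by
      have : μl = 0 := Subtype.ext h0
      rw [this, map_zero] at hμ1
      exact zero_ne_one hμ1
    refine le_antisymm ((C.V.valuation_le_one_iff _).mpr h1) ?_
    have h3 := (C.V.valuation_le_one_iff _).mpr h2
    rwa [map_inv₀, inv_le_one₀ ((Valuation.pos_iff _).mpr hμ0)] at h3
  · -- the dichotomy
    set U : ValuationSubring l := W.comap (algebraMap l Ω) with hU
    have hμ0 : (μl : Ω) ≠ 0 := fun h0 => by rw [h0, map_zero] at hWμ; exact zero_ne_one hWμ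
    have hμl0 : μl ≠ 0 := fun h0 => hμ0 (by rw [h0]; rfl)
    have hUμ : U.valuation μl = 1 := by
      have h1 : μl ∈ U := (W.valuation_le_one_iff _).mp hWμ.le
      have h2 : μl⁻¹ ∈ U :=
        (W.valuation_le_one_iff _).mp (by
          change W.valuation ((μl : Ω))⁻¹ ≤ 1
          rw [map_inv₀, hWμ, inv_one])
      refine le_antisymm ((U.valuation_le_one_iff _).mpr h1) ?_
      have h3 := (U.valuation_le_one_iff _).mpr h2
      rwa [map_inv₀, inv_le_one₀ ((Valuation.pos_iff _).mpr hμl0)] at h3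
    rcases eq_or_eq_top_of_valuation_eq_one C.Ok_max hμlt U (hmemU W hW) hUμ with hUW | hUtop
    · right
      intro z hz
      have hz' : z ∈ l := C.mem_m_iff.mp hz
      change ((⟨z, hz'⟩ : l) : Ω) ∈ W ↔ ((⟨z, hz'⟩ : l) : Ω) ∈ C.V
      change (⟨z, hz'⟩ : l) ∈ U ↔ (⟨z, hz'⟩ : l) ∈ Wl
      rw [hUW]
    · left
      intro z hz
      have hz' : z ∈ l := C.mem_m_iff.mp hz
      have : (⟨z, hz'⟩ : l) ∈ U := by rw [hUtop]; exact ValuationSubring.mem_top _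
      exact this

/-! ### The charts `T₀ ⊆ T₁ = T₀[1/μ] ⊆ T = T₁[1/b]` -/

omit [IsAlgClosed Ω] [FiniteDimensional K L₁] in
/-- `B[1/f]` is étale over `R` if `B` is. [folklore] -/
theorem etale_locAway_of_etale {R : Type u} [CommRing R] [Algebra R Ω] {B : Subalgebra R Ω} {f : Ω}
    {hf : f ∈ B} (hf0 : f ≠ 0) [Algebra.Etale R B] : Algebra.Etale R (locAway B f hf) := by
  letI := (Subalgebra.inclusion (le_locAway (B := B) (f := f) (hf := hf))).toRingHom.toAlgebra
  haveI : IsScalarTower R B (locAway B f hf) := IsScalarTower.of_algebraMap_eq fun _ => rfl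
  haveI := isLocalization_locAway (B := B) (hf := hf) hf0
  haveI : Algebra.Etale B (locAway B f hf) := Algebra.Etale.of_isLocalizationAway (⟨f, hf⟩ : B)
  exact Algebra.Etale.comp R B (locAway B f hf)

/-- The Hensel chart `T₀`. [folklore] -/
def T₀ : Subalgebra C.N'' Ω := C.exists_T₀.choose

/-- Its unit `u_D`. [folklore] -/
def uD : Ω := C.exists_T₀.choose_spec.choose

/-- The specification of `T₀, u_D`. [folklore] -/
theorem T₀_spec : Algebra.Etale C.N'' C.T₀ ∧ C.y₀ ∈ C.T₀ ∧ C.uD ∈ C.T₀ ∧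
    C.T₀ = Algebra.adjoin C.N''
      ({(C.y₀ - algebraMap C.N'' Ω C.yR) / algebraMap C.N'' Ω ((derivative C.PR).eval C.yR), C.uD} :
        Set Ω) ∧
    (∀ F : Subfield Ω, (∀ r : C.N'', algebraMap C.N'' Ω r ∈ F) → C.y₀ ∈ F → C.uD ∈ F) ∧
    C.T₀.toSubring ≤ C.V.toSubring ∧ C.V.valuation C.uD = 1 ∧
    C.uD * Polynomial.aeval
      ((C.y₀ - algebraMap C.N'' Ω C.yR) / algebraMap C.N'' Ω ((derivative C.PR).eval C.yR))
      (derivative (zoomPoly C.PR C.yR C.βR)) = 1 :=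
  C.exists_T₀.choose_spec.choose_spec

/-- `u_D w₀ = 1`. [folklore] -/
theorem uD_mul_w₀ : C.uD * C.w₀ = 1 := by
  rw [w₀_eq]; exact C.T₀_spec.2.2.2.2.2.2.2

/-- `|w₀| = 1`. [folklore] -/
theorem valuation_w₀ : C.V.valuation C.w₀ = 1 := by
  have h := congrArg C.V.valuation C.uD_mul_w₀
  rw [map_mul, map_one, C.T₀_spec.2.2.2.2.2.2.1, one_mul] at h
  exact h

/-- `T₀` is étale over `R`. [folklore] -/
theorem etale_T₀ : Algebra.Etale C.N'' C.T₀ := C.T₀_spec.1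

/-- `y₀ ∈ T₀`. [folklore] -/
theorem y₀_mem_T₀ : C.y₀ ∈ C.T₀ := C.T₀_spec.2.1

/-- `T₀ ⊆ O_V`. [folklore] -/
theorem T₀_le_V : C.T₀.toSubring ≤ C.V.toSubring := C.T₀_spec.2.2.2.2.2.1

/-- `k° ⊆ T` for every `R`-subalgebra `T` of `Ω`. [folklore] -/
theorem algebraMap_mem_of_mem_Ok (T : Subalgebra C.N'' Ω) {c₀ : k} (hc₀ : c₀ ∈ C.Ok) :
    algebraMap k Ω c₀ ∈ T :=
  T.algebraMap_mem ⟨_, C.algebraMap_mem_N''_of_mem_Ok hc₀⟩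

/-- The separating constant `μ`. [folklore] -/
def μ : Ω := C.exists_μ.choose

/-- `μ ∈ m`. [folklore] -/
theorem μ_mem_m : C.μ ∈ C.m := C.exists_μ.choose_spec.1

/-- `|μ| = 1`. [folklore] -/
theorem valuation_μ : C.V.valuation C.μ = 1 := C.exists_μ.choose_spec.2.1

/-- `μ` lies in every valuation ring over `k°`. [folklore] -/
theorem μ_mem_of (W : ValuationSubring Ω) (hW : ∀ c₀ ∈ C.Ok, algebraMap k Ω c₀ ∈ W) : C.μ ∈ W :=
  C.exists_μ.choose_spec.2.2.1 W hW

/-- The dichotomy at `μ`. [folklore] -/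
theorem μ_dichotomy (W : ValuationSubring Ω) (hW : ∀ c₀ ∈ C.Ok, algebraMap k Ω c₀ ∈ W)
    (hWμ : W.valuation C.μ = 1) : (∀ z ∈ C.m, z ∈ W) ∨ (∀ z ∈ C.m, z ∈ W ↔ z ∈ C.V) :=
  C.exists_μ.choose_spec.2.2.2 W hW hWμ

/-- `μ ≠ 0`. [folklore] -/
theorem μ_ne_zero : C.μ ≠ 0 := fun h0 => by
  have h := C.valuation_μ
  rw [h0, map_zero] at h
  exact zero_ne_one h

/-- `μ ∈ T₀` (it is `k°`-integral and `m`-rational). [folklore] -/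
theorem μ_mem_T₀ : C.μ ∈ C.T₀ :=
  C.mem_of_mem_m_of_forall C.etale_T₀ C.y₀_mem_T₀ C.μ_mem_m fun W hW =>
    C.μ_mem_of W fun _ hc₀ => hW (C.algebraMap_mem_of_mem_Ok C.T₀ hc₀)

/-- **`T₁ = T₀[1/μ]`.** [folklore] -/
def T₁ : Subalgebra C.N'' Ω := locAway C.T₀ C.μ C.μ_mem_T₀

/-- `T₁` is étale over `R`. [folklore] -/
theorem etale_T₁ : Algebra.Etale C.N'' C.T₁ := by
  haveI := C.etale_T₀
  exact etale_locAway_of_etale C.μ_ne_zero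

/-- `T₀ ≤ T₁`. [folklore] -/
theorem T₀_le_T₁ : C.T₀ ≤ C.T₁ := le_locAway

/-- `T₁ ⊆ O_V`. [folklore] -/
theorem T₁_le_V : C.T₁.toSubring ≤ C.V.toSubring := locAway_le_valuationSubring C.T₀_le_V C.valuation_μ

/-- **The sheet property of `T₁`.** A valuation ring `W ⊇ T₁` either contains `m`, or induces
`m ∩ O_V` on `m` and then `O_V` on the Galois extension `M` (because `M ∩ L₁^h ⊆ m` and `L₁^h`
is henselian). [folklore] -/
theorem sheet (W : ValuationSubring Ω) (hW : C.T₁.toSubring ≤ W.toSubring) :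
    (∀ z ∈ C.m, z ∈ W) ∨
    ((∀ z ∈ C.m, z ∈ W ↔ z ∈ C.V) ∧
      ∀ z : C.M, ((z : algebraicClosure C.m Ω) : Ω) ∈ W ↔ ((z : algebraicClosure C.m Ω) : Ω) ∈ C.V) := by
  have hk : ∀ c₀ ∈ C.Ok, algebraMap k Ω c₀ ∈ W := fun c₀ hc₀ =>
    hW (C.T₀_le_T₁ (C.algebraMap_mem_of_mem_Ok C.T₀ hc₀))
  have hWμ : W.valuation C.μ = 1 := by
    have h1 : C.μ ∈ W := hW (C.T₀_le_T₁ C.μ_mem_T₀)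
    have h2 : C.μ⁻¹ ∈ W := hW (inv_mem_locAway (hf := C.μ_mem_T₀) C.μ_ne_zero)
    refine le_antisymm ((W.valuation_le_one_iff _).mpr h1) ?_
    have h3 := (W.valuation_le_one_iff _).mpr h2
    rwa [map_inv₀, inv_le_one₀ ((Valuation.pos_iff _).mpr C.μ_ne_zero)] at h3
  rcases C.μ_dichotomy W hk hWμ with h | h
  · exact Or.inl h
  · refine Or.inr ⟨h, fun z => ?_⟩
    have hL : IsHenselianField C.L (C.V.comap (algebraMap C.L Ω)) :=
      Kuhlmann2010HenselizationIsHenselian_holds Ω C.V _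
    exact mem_iff_mem_of_isGalois_of_forall_mem C.V C.m C.M C.L C.m_le_L hL C.hML W h z

/-- **`m° ⊆ T₁`.** [folklore] -/
theorem mem_T₁_of_mem_m {z : Ω} (hzm : z ∈ C.m) (hzV : z ∈ C.V) : z ∈ C.T₁ :=
  C.mem_of_mem_m_of_forall C.etale_T₁ (C.T₀_le_T₁ C.y₀_mem_T₀) hzm fun W hW => by
    rcases C.sheet W hW with h | ⟨h, -⟩
    · exact h z hzm
    · exact (h z hzm).mpr hzV

/-- `x ∈ T₁`. [folklore] -/
theorem xΩ_mem_T₁ : C.xΩ ∈ C.T₁ := C.T₀_le_T₁ (C.T₀.algebraMap_mem ⟨_, C.xΩ_mem_N''⟩)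

/-- `g_K ∈ T₁`. [folklore] -/
theorem gKΩ_mem_T₁ : algebraMap K Ω C.gK ∈ C.T₁ := C.T₀_le_T₁ (C.T₀.algebraMap_mem ⟨_, C.gKΩ_mem_N''⟩)

/-- `Z ⊆ T₁`. [folklore] -/
theorem algebraMap_mem_T₁_of_mem_Z {z : L₁} (hz : z ∈ C.Z) : algebraMap L₁ Ω z ∈ C.T₁ :=
  C.T₀_le_T₁ (C.T₀.algebraMap_mem ⟨_, C.algebraMap_mem_N''_of_mem_Z hz⟩)

/-- **The sheet cutter lies in `T₁`.** [folklore] -/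
theorem b_mem_T₁ : C.b ∈ C.T₁ := by
  obtain ⟨u, hum, huV, hu0, z, hz, q, hq, hub⟩ := C.hbfracZ
  have huT : u ∈ C.T₁ := C.mem_T₁_of_mem_m hum huV
  have hzT : algebraMap L₁ Ω z ∈ C.T₁ := by
    rcases hz with rfl | hz
    · exact C.xΩ_mem_T₁
    · exact C.algebraMap_mem_T₁_of_mem_Z hz
  have hqT : q.eval (algebraMap L₁ Ω z) ∈ C.T₁ := by
    rw [Polynomial.eval_eq_sum_range]
    exact C.T₁.sum_mem fun i _ =>
      C.T₁.mul_mem (C.mem_T₁_of_mem_m (hq i).1 (hq i).2) (C.T₁.pow_mem hzT i)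
  haveI := C.etale_T₁
  haveI : IsIntegrallyClosed C.N'' := C.isIntegrallyClosed_N''
  refine mem_of_forall_valuationSubring_of_mul_mem (R := C.N'') Subtype.val_injective C.T₁
    (fun W hW => ?_) huT hu0 (by rw [hub]; exact hqT)
  rcases C.sheet W hW with h | ⟨-, hM⟩
  · -- `m ⊆ W`: `b = q(x)/u` with `u⁻¹ ∈ W`
    have hu' : u⁻¹ ∈ W := by
      have := h u⁻¹ (C.m.inv_mem hum)
      exact this
    have : C.b = u⁻¹ * q.eval (algebraMap L₁ Ω z) := by
      rw [← hub, ← mul_assoc, inv_mul_cancel₀ hu0, one_mul]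
    rw [this]
    exact W.mul_mem _ _ hu' (hW hqT)
  · exact C.hbmemZ W (hW C.xΩ_mem_T₁) (hW C.gKΩ_mem_T₁)
      (fun z hz => hW (C.algebraMap_mem_T₁_of_mem_Z hz)) hM

/-- `b ≠ 0`. [folklore] -/
theorem b_ne_zero : C.b ≠ 0 := fun h0 => by
  have h := C.hvb
  rw [h0, map_zero] at h
  exact zero_ne_one h

/-- **`T = T₁[1/b]`**, the `K`-side chart before restriction of scalars. [folklore] -/
def T : Subalgebra C.N'' Ω := locAway C.T₁ C.b C.b_mem_T₁

/-- `T` is étale over `R`. [folklore] -/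
theorem etale_T : Algebra.Etale C.N'' C.T := by
  haveI := C.etale_T₁
  exact etale_locAway_of_etale C.b_ne_zero

/-- `T₁ ≤ T`. [folklore] -/
theorem T₁_le_T : C.T₁ ≤ C.T := le_locAway

/-- `T ⊆ O_V`. [folklore] -/
theorem T_le_V : C.T.toSubring ≤ C.V.toSubring := locAway_le_valuationSubring C.T₁_le_V C.hvb

/-- **The disc coordinate lies in `T`**: `x′ = (x − a)/c ∈ T`. [folklore] -/
theorem x'_mem_T : C.x' ∈ C.T := by
  haveI := C.etale_T
  haveI : IsIntegrallyClosed C.N'' := C.isIntegrallyClosed_N''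
  have hcT : C.c ∈ C.T := C.T₁_le_T (C.mem_T₁_of_mem_m C.hcm C.hcV)
  have haT : C.a ∈ C.T := C.T₁_le_T (C.mem_T₁_of_mem_m C.ham C.haV)
  have hxT : C.xΩ ∈ C.T := C.T₁_le_T C.xΩ_mem_T₁
  refine mem_of_forall_valuationSubring_of_mul_mem (R := C.N'') Subtype.val_injective C.T
    (fun W hW => ?_) hcT C.hc0 (by
      rw [x', mul_div_cancel₀ _ C.hc0]
      exact C.T.sub_mem hxT haT)
  -- `|b|_W = 1`
  have hWb : W.valuation C.b = 1 := by
    have h1 : C.b ∈ W := hW (C.T₁_le_T C.b_mem_T₁)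
    have h2 : C.b⁻¹ ∈ W := hW (inv_mem_locAway (hf := C.b_mem_T₁) C.b_ne_zero)
    refine le_antisymm ((W.valuation_le_one_iff _).mpr h1) ?_
    have h3 := (W.valuation_le_one_iff _).mpr h2
    rwa [map_inv₀, inv_le_one₀ ((Valuation.pos_iff _).mpr C.b_ne_zero)] at h3
  have hW₁ : C.T₁.toSubring ≤ W.toSubring := fun w hw => hW (C.T₁_le_T hw)
  have hle : W.valuation (C.xΩ - C.a) ≤ W.valuation C.c := by
    rcases C.sheet W hW₁ with h | ⟨-, hM⟩
    · -- `m ⊆ W`: `|c|_W = 1 ≥ |x − a|_W`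
      have hc1 : W.valuation C.c = 1 := by
        have h1 : C.c ∈ W := h _ C.hcm
        have h2 : C.c⁻¹ ∈ W := h _ (C.m.inv_mem C.hcm)
        refine le_antisymm ((W.valuation_le_one_iff _).mpr h1) ?_
        have h3 := (W.valuation_le_one_iff _).mpr h2
        rwa [map_inv₀, inv_le_one₀ ((Valuation.pos_iff _).mpr C.hc0)] at h3
      rw [hc1]
      exact (W.valuation_le_one_iff _).mpr (W.sub_mem (hW hxT) (h _ C.ham))
    · exact C.hbcutZ W (hW hxT) (hW (C.T₁_le_T C.gKΩ_mem_T₁))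
        (fun z hz => hW (C.T₁_le_T (C.algebraMap_mem_T₁_of_mem_Z hz))) hM hWb
  rw [← W.valuation_le_one_iff, x', map_div₀]
  exact div_le_one_of_le₀ hle zero_le

end RelCurveChart

end Literature.AlgebraicGeometry.Resolution

end
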